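import Summits.QuantumFields.YangMills.Theorems.BalabanUVNodesN15KingModelFullPropagatorBgLetters
import Summits.QuantumFields.YangMills.Theorems.BalabanUVNodesN15BackwardShift
import HarnessLib

/-!
# N15 (NE2), King-model rung — THE CONSTRAINT TERM `T = a_K·Q*Q·A₀⁻¹` OF KING's FULL `A = 0` PROPAGATOR, part 1∕2 (scalar lattice algebra):
# `T = 1 + N²ΔA₀⁻¹ − m²A₀⁻¹`, `Q*Q∘T = T`, `N²ΔA₀⁻¹ = −Σ_μ N(s_μ⁻¹ − 1)∘D_μ`, ★ THE FACE LEMMA «a block mean of a scaled backward difference is two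
# face means», ★ THE BLOCK MEAN ANNIHILATES THE CELL OSCILLATION `𝔇(M_{c′}, M_{blockAvg c′})` OF KING's PAIRING EXACTLY

WHY (cell `pub-ymgap`, seat `pub-ymgap-dag-n15-d`, R134 N15 NE2 s3 «King-model rung», generation 21; ARCHITECTURE NOTE INBOX l.42576).  In the
first-order dressed model of dag-n15-a's programme K (`X = G + GVX`, `G = A₀⁻¹`, `A₀ = N²(−Δ) + m² + a_K·Q*Q` = `King1986.Torus.fineOp`,
`V = M_c + Σ_μ M_{a_μ}N∇_μ`) the COVARIANT Laplacian entry of [Balaban1985BackgroundPropagators] (3.42) (fourth entry, `|Δ_U Gλ|`) is, by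
`(A₀ − V)X = 1`, EXACTLY `N²Δ_V X := (N²Δ + V)X = m²X + T(1 + VX) − 1` with the CONSTRAINT TERM `T := a_K·Q*Q·A₀⁻¹` — so its two-grid
η-defect is rated by the jet defects of K-B, the plain ∕ defect letters of `T` (this file's identity `T = 1 + N²ΔA₀⁻¹ − m²A₀⁻¹` + part Σ-a), and
ONE new row: the CELL-OSCILLATION ROW `T′∘𝔇(M_{c′}, M_{blockAvg c′})` (part 2∕2 `…KingModelConstraintCellOscillation`).  This part supplies the
scalar lattice facts behind that row: `T′ = Q′*Q′∘T′` and `T′ = 1 − Σ_μ N′(s_μ⁻¹ − 1)∘D′_μ − m²G′`, hence `T′∘𝔇M = Q′*Q′∘𝔇M − Σ_μ [Q′*Q′∘N′(s_μ⁻¹ −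
1)]∘[D′_μ∘𝔇M] − m²·Q′*Q′∘[G′∘𝔇M]`, where `Q′*Q′∘𝔇M = 0` EXACTLY (§4: King's cells tile the unit blocks and `c′ − blockAvg c′∘π` has zero cell
sums against the cell-constant `Pg`) and `Q′*Q′∘N′(s_μ⁻¹ − 1)` costs two FACE means (§3: telescoping along `μ`-lines of a unit block).

WHAT (0 `sorry`, 0 `def`, standard axioms; ns `Summit.QuantumFields.YangMills.BalabanUVNodes.N15.KingModel.Constraint`).  The three operators are
written out, no abbreviation: the block-mean projector `Q*Q := mulVecLin (blockProj N M)` (King's (4.36), the matrix of `King1986.Torus.fineOp`'s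
constraint), the constraint term `T := a_K • (mulVecLin (blockProj N M) ∘ₗ kingGOp L a m² K N M)`, the scaled backward difference
`N(s_κ⁻¹ − 1) := N • (pull (· − e_κ) − id)` (so that Σ-a's `kingSOp = kingGOp ∘ₗ N(s_κ⁻¹ − 1)` on the nose).
* §1 `constraint_apply`, `bdiff_apply`, ★ `constraint_eq_id_add_kingLapOp_sub` (`T = 1 + N²ΔA₀⁻¹ − m²·A₀⁻¹`, n15-e Q4b `lap_inv_mulVec_eq`),
  `kingLapOp_eq_neg_sum_bdiff_comp_kingDOp` (`N²ΔA₀⁻¹ = −Σ_μ N(s_μ⁻¹ − 1)∘D_μ`, `D_μ = N∇_μA₀⁻¹` = Σ-a `kingDOp`), `blockMean_comp_blockMean` (`Q*Q`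
  idempotent), `blockMean_comp_constraint` (`Q*Q∘T = T`), `kingSOp_eq_kingGOp_comp_bdiff` (`rfl`).
* §2 block sums: `sum_ite_blockOf_eq_sum_site`, `blockMean_apply_eq_sum`, `abs_blockMean_apply_le`.
* §3 ★ THE FACE LEMMA: `sum_line_bdiff_eq` (telescoping along one `κ`-line of a unit block), `sum_block_bdiff_eq` (a block sum of backward
  differences = entering-face sum − leaving-face sum, `Fin.insertNthEquiv`), ★ `abs_blockMean_bdiff_apply_le`: for `v` vanishing off the unit
  block `y″` with `|v| ≤ S`, `|(Q*Q∘N(s_κ⁻¹ − 1))v (x)| ≤ (2·𝟙[y″ = B(x)] + 𝟙[y″ = B(x) − e_κ])·S`.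
* §4 ★ THE ANNIHILATION: `fibre_kingPrV_eq_map`, `sum_fibre_sub_blockAvg` (zero cell sums), ★ `tensorId_blockMean_comp_idef_mulOp_blockAvg`:
  `(Q′*Q′ ⊗ 1) ∘ 𝔇(M_{c′}, M_{blockAvg_{π} c′}) = 0` through King's bond pairing `π = kingPrV L k m M` (1-form carrier, dag-n15-a III-B's currency).
HONEST FRAMING ∕ LIMITS.  Count-neutral lattice bookkeeping on King's `A = 0` MODEL (template literature — C. King's scalar U(1)-Higgs model on finite
tori, [King1986] (4.1)–(4.5) p. 670, (4.36) p. 674, p. 664 (pairing)), NOT Bałaban's covariant `G(U)`; [Balaban1985BackgroundPropagators] (3.42) p. 397,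
(3.52) p. 400, (3.62)–(3.65) p. 402 are cited as the MECHANISM of the dressed pair only.  No estimate of [B9] is asserted; NE2⁺ is NOT PRINTED and NOT
proved here; N15 is NOT discharged; K3⁸ OPEN; counts of record UNMOVED (typed 28∕28 · discharged 5∕27 · A 5∕28); one finite torus at fixed spacings —
NOT ℝ⁴ ∕ infinite volume ∕ OS ∕ mass gap ∕ Clay.  `--kind proof --supports stmt-QuantumFields-27366 --as helper` (K3⁸).
-/

noncomputable section

open scoped BigOperators
open Finset Matrix

namespace Summit.QuantumFields.YangMills.BalabanUVNodes.N15.KingModel.Constraint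

open Literature.MathematicalPhysics.QuantumFieldTheory.Balaban1983to89
open Literature.MathematicalPhysics.QuantumFieldTheory.Balaban1983to89.T4EtaRateDefect (idef idef_apply)
open Literature.MathematicalPhysics.QuantumFieldTheory.Balaban1983to89.T4EtaRateCoeffDefect (pull pull_apply blockAvg fibre mem_fibre idef_mulOp_apply)
open Literature.MathematicalPhysics.QuantumFieldTheory.Balaban1983to89.B6Prop26Gluing (mulOp mulOp_apply)
open Literature.MathematicalPhysics.QuantumFieldTheory.Balaban1983to89.B5Prop11Plancherel (Tor fine unitVec)
open Literature.MathematicalPhysics.QuantumFieldTheory.King1986 (aK aK_pos)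
open Literature.MathematicalPhysics.QuantumFieldTheory.King1986.Torus (fineOp blockOf blockProj site blockEquiv blockEquiv_apply blockOf_site)
open Summit.QuantumFields.YangMills.BalabanUVNodes.N15.VectorPiece (kingPr kingPrV kingPrV_eq blkFine blkFine_comp_kingPrV tensorId tensorId_apply
  blockOf_sub_unitVec)
open Summit.QuantumFields.YangMills.BalabanUVNodes.N15KingModelRung.Curved (kingGOp kingDOp kingSOp kingLapOp kingGOp_apply kingDOp_apply kingLapOp_apply
  lap_inv_mulVec_eq blockProj_mulVec_apply sum_blockIndicator)

variable {d : ℕ} {L : ℕ}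

/-! ## §1 The identities: `T = 1 + N²ΔA₀⁻¹ − m²A₀⁻¹`, `N²ΔA₀⁻¹ = −Σ_μ N(s_μ⁻¹ − 1)∘D_μ`, `Q*Q∘Q*Q = Q*Q`, `Q*Q∘T = T` -/

section Identities

variable (a msq : ℝ) (K N : ℕ) [NeZero N] (M : Fin (d + 1) → ℕ) [∀ μ, NeZero (M μ)]

/-- Unfolding of the CONSTRAINT TERM `T = a_K·Q*Q·A₀⁻¹` of King's full `A = 0` propagator (`A₀ = N²(−Δ) + m² + a_K·Q*Q`, `Q*Q` = the block-mean
projector `blockProj`): `(Tλ)(x) = a_K·(Q*Q(A₀⁻¹λ))(x)`. [cite: King1986, (4.1)–(4.5) p.670, (4.36) p.674] -/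
theorem constraint_apply (L : ℕ) (lam : Tor (fine N M) → ℝ) (x : Tor (fine N M)) :
    (aK a L K • (Matrix.mulVecLin (blockProj N M) ∘ₗ kingGOp L a msq K N M)) lam x
      = aK a L K * (blockProj N M *ᵥ ((fineOp N M (aK a L K) (((N : ℕ) : ℝ) ^ 2) msq)⁻¹ *ᵥ lam)) x := by
  simp only [kingGOp, LinearMap.smul_apply, LinearMap.coe_comp, Function.comp_apply, Matrix.mulVecLin_apply, Pi.smul_apply, smul_eq_mul]

omit [NeZero N] [∀ μ, NeZero (M μ)] in
/-- Unfolding of the SCALED BACKWARD DIFFERENCE `N(s_κ⁻¹ − 1) = N•(pull (· − e_κ) − id)`: `v ↦ N·(v(x − e_κ) − v(x))` — the adjoint divergence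
`N∇*_κ` of [B9] (3.42) (third entry); Σ-a's `kingSOp` is `kingGOp ∘ₗ N(s_κ⁻¹ − 1)` on the nose. [cite: Balaban1985BackgroundPropagators, (3.42) p.397 (third entry, shape)] -/
theorem bdiff_apply (κ : Fin (d + 1)) (v : Tor (fine N M) → ℝ) (x : Tor (fine N M)) :
    (((N : ℝ) • (pull (fun y : Tor (fine N M) => y - unitVec (fine N M) κ) - LinearMap.id)) : (Tor (fine N M) → ℝ) →ₗ[ℝ] (Tor (fine N M) → ℝ)) v x
      = (N : ℝ) * (v (x - unitVec (fine N M) κ) - v x) := by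
  simp only [LinearMap.smul_apply, LinearMap.sub_apply, Pi.smul_apply, Pi.sub_apply, pull_apply, LinearMap.id_coe, id_eq, smul_eq_mul]

/-- Σ-a's `S_κ = A₀⁻¹∘N∇*_κ` IS `kingGOp ∘ₗ N(s_κ⁻¹ − 1)` (definitionally). [folklore] -/
theorem kingSOp_eq_kingGOp_comp_bdiff (L : ℕ) (κ : Fin (d + 1)) :
    kingSOp L a msq K N M κ = kingGOp L a msq K N M ∘ₗ ((N : ℝ) • (pull (fun y : Tor (fine N M) => y - unitVec (fine N M) κ) - LinearMap.id)) := rfl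

/-- ★ **`T = 1 + N²ΔA₀⁻¹ − m²·A₀⁻¹`**: the constraint term through the equation `A₀A₀⁻¹ = 1` read in Laplacian form (n15-e Q4b `lap_inv_mulVec_eq`:
`N²Σ_μ[g(x+e_μ) + g(x−e_μ) − 2g(x)] = m²g(x) + a_K(Q*Qg)(x) − λ(x)`, `g = A₀⁻¹λ`); needs `a > 0`, `L ≥ 2`, `K ≥ 1`, `m² > 0` (invertibility).
[cite: King1986, (4.1)–(4.5) p.670; Balaban1983RegularityDecay, (1.6) p.572] -/
theorem constraint_eq_id_add_kingLapOp_sub (hL : 2 ≤ L) {a : ℝ} (ha : 0 < a) {K : ℕ} (hK : 1 ≤ K) {msq : ℝ} (hmsq : 0 < msq) :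
    aK a L K • (Matrix.mulVecLin (blockProj N M) ∘ₗ kingGOp L a msq K N M) = LinearMap.id + kingLapOp L a msq K N M - msq • kingGOp L a msq K N M := by
  have hL1 : (1 : ℝ) < (L : ℝ) := by exact_mod_cast (show 1 < L by omega)
  have haK : 0 ≤ aK a (L : ℝ) K := (aK_pos ha hL1 hK).le
  refine LinearMap.ext fun lam => funext fun x => ?_
  have h := lap_inv_mulVec_eq N M (a := aK a L K) (c := ((N : ℕ) : ℝ) ^ 2) (m2 := msq) haK (pow_nonneg (Nat.cast_nonneg _) _) hmsq lam x
  simp only [LinearMap.sub_apply, LinearMap.add_apply, LinearMap.smul_apply, LinearMap.id_coe, id_eq, Pi.add_apply, Pi.sub_apply, Pi.smul_apply,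
    smul_eq_mul, constraint_apply, kingLapOp_apply, kingGOp_apply]
  rw [h]
  ring

/-- **`N²ΔA₀⁻¹ = −Σ_μ N(s_μ⁻¹ − 1)∘D_μ`** (`D_μ = N∇_μA₀⁻¹` the forward gradient): the lattice Laplacian is minus the sum of backward differences of
forward differences. [cite: King1986, (4.1) p.670 (Δ^η)] -/
theorem kingLapOp_eq_neg_sum_bdiff_comp_kingDOp (L : ℕ) :
    kingLapOp L a msq K N M = -∑ μ : Fin (d + 1), (((N : ℝ) • (pull (fun y : Tor (fine N M) => y - unitVec (fine N M) μ) - LinearMap.id))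
      ∘ₗ kingDOp L a msq K N M μ) := by
  refine LinearMap.ext fun lam => funext fun x => ?_
  simp only [kingLapOp_apply, LinearMap.neg_apply, Pi.neg_apply, LinearMap.coe_sum, Finset.sum_apply, LinearMap.coe_comp, Function.comp_apply,
    bdiff_apply, kingDOp_apply, sub_add_cancel]
  rw [Finset.mul_sum, ← Finset.sum_neg_distrib]
  refine Finset.sum_congr rfl fun μ _ => ?_
  ring

/-- **`Q*Q` is idempotent**: the block mean of a block mean is the block mean. [cite: King1986, (4.36) p.674] -/
theorem blockMean_comp_blockMean : Matrix.mulVecLin (blockProj N M) ∘ₗ Matrix.mulVecLin (blockProj N M) = Matrix.mulVecLin (blockProj N M) := by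
  refine LinearMap.ext fun g => funext fun x => ?_
  have hconst : ∀ y, blockOf N M x = blockOf N M y → (blockProj N M *ᵥ g) y = (blockProj N M *ᵥ g) x := fun y hy => by
    rw [blockProj_mulVec_apply, blockProj_mulVec_apply, hy]
  rw [LinearMap.comp_apply, Matrix.mulVecLin_apply, Matrix.mulVecLin_apply, blockProj_mulVec_apply]
  calc ∑ y, (if blockOf N M x = blockOf N M y then (((N : ℝ) ^ (d + 1))⁻¹) else 0) * (blockProj N M *ᵥ g) y
      = ∑ y, (if blockOf N M x = blockOf N M y then (((N : ℝ) ^ (d + 1))⁻¹) else 0) * (blockProj N M *ᵥ g) x := by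
        refine Finset.sum_congr rfl fun y _ => ?_
        by_cases hy : blockOf N M x = blockOf N M y
        · rw [hconst y hy]
        · rw [if_neg hy, zero_mul, zero_mul]
    _ = (blockProj N M *ᵥ g) x := by rw [← Finset.sum_mul, sum_blockIndicator, one_mul]

/-- **`Q*Q∘T = T`**: the constraint term has block-constant range. [cite: King1986, (4.36) p.674] -/
theorem blockMean_comp_constraint (L : ℕ) :
    Matrix.mulVecLin (blockProj N M) ∘ₗ (aK a L K • (Matrix.mulVecLin (blockProj N M) ∘ₗ kingGOp L a msq K N M))
      = aK a L K • (Matrix.mulVecLin (blockProj N M) ∘ₗ kingGOp L a msq K N M) := by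
  rw [LinearMap.comp_smul, ← LinearMap.comp_assoc, blockMean_comp_blockMean]

end Identities

/-! ## §2 Block sums through the block parametrisation `y = N·b + j` -/

section BlockSums

variable (N : ℕ) [NeZero N] (M : Fin (d + 1) → ℕ) [∀ μ, NeZero (M μ)]

/-- `Σ_y [B(y) = b]·F(y) = Σ_{j ∈ [0,N)^{d+1}} F(N·b + j)`. [folklore] -/
theorem sum_ite_blockOf_eq_sum_site (F : Tor (fine N M) → ℝ) (b : Tor M) :
    ∑ y, (if blockOf N M y = b then F y else 0) = ∑ j : Fin (d + 1) → Fin N, F (site N M b j) := by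
  rw [← (blockEquiv N M).sum_comp (fun y => if blockOf N M y = b then F y else 0), Fintype.sum_prod_type]
  simp only [blockEquiv_apply, blockOf_site]
  rw [Finset.sum_comm]
  simp only [Finset.sum_ite_eq', Finset.mem_univ, if_true]

/-- The block mean as a sum over block offsets: `(Q*Qg)(x) = N^{−(d+1)}·Σ_j g(N·B(x) + j)`. [cite: King1986, (4.36) p.674] -/
theorem blockMean_apply_eq_sum (g : Tor (fine N M) → ℝ) (x : Tor (fine N M)) :
    Matrix.mulVecLin (blockProj N M) g x = ((N : ℝ) ^ (d + 1))⁻¹ * ∑ j : Fin (d + 1) → Fin N, g (site N M (blockOf N M x) j) := by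
  rw [Matrix.mulVecLin_apply, blockProj_mulVec_apply, ← sum_ite_blockOf_eq_sum_site, Finset.mul_sum]
  refine Finset.sum_congr rfl fun y _ => ?_
  by_cases hy : blockOf N M x = blockOf N M y
  · rw [if_pos hy, if_pos hy.symm]
  · rw [if_neg hy, if_neg (Ne.symm hy), zero_mul, mul_zero]

/-- A block mean is bounded by the sup over the block. [folklore] -/
theorem abs_blockMean_apply_le (g : Tor (fine N M) → ℝ) (x : Tor (fine N M)) {S : ℝ} (hS : ∀ y, blockOf N M y = blockOf N M x → |g y| ≤ S) :
    |Matrix.mulVecLin (blockProj N M) g x| ≤ S := by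
  have hS0 : 0 ≤ S := (abs_nonneg _).trans (hS x rfl)
  have hN : (0 : ℝ) < (N : ℝ) ^ (d + 1) := pow_pos (by exact_mod_cast Nat.pos_of_ne_zero (NeZero.ne N)) _
  rw [blockMean_apply_eq_sum, abs_mul, abs_of_pos (inv_pos.mpr hN)]
  calc ((N : ℝ) ^ (d + 1))⁻¹ * |∑ j : Fin (d + 1) → Fin N, g (site N M (blockOf N M x) j)|
      ≤ ((N : ℝ) ^ (d + 1))⁻¹ * ∑ j : Fin (d + 1) → Fin N, S := by
        refine mul_le_mul_of_nonneg_left ((Finset.abs_sum_le_sum_abs _ _).trans (Finset.sum_le_sum fun j _ => ?_)) (inv_pos.mpr hN).le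
        exact hS _ (blockOf_site N M _ j)
    _ = S := by
        rw [Finset.sum_const, Finset.card_univ, Fintype.card_pi, Finset.prod_const, Fintype.card_fin, Finset.card_univ, Fintype.card_fin, nsmul_eq_mul]
        push_cast
        field_simp

end BlockSums

/-! ## §3 ★ The face lemma: a block mean of a scaled backward difference is two face means -/

section Face

variable (N : ℕ) [NeZero N] (M : Fin (d + 1) → ℕ) [∀ μ, NeZero (M μ)]

omit [∀ μ, NeZero (M μ)] in
/-- TELESCOPING ALONG ONE `κ`-LINE OF A UNIT BLOCK: `Σ_{t<N}[v(z_t − e_κ) − v(z_t)] = v(z_0 − e_κ) − v(z_{N−1})`, `z_t = N·b + (j′ with j_κ := t)`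
(`Fin.insertNth`); the line is parametrised by `s ∈ ℕ ↦ N·b + (j′, j_κ := s)` as a residue, along which one lattice step back lowers `s` by one. [folklore] -/
theorem sum_line_bdiff_eq (v : Tor (fine N M) → ℝ) (b : Tor M) (κ : Fin (d + 1)) (j' : Fin d → Fin N) :
    ∑ t : Fin N, (v (site N M b (Fin.insertNth κ t j') - unitVec (fine N M) κ) - v (site N M b (Fin.insertNth κ t j')))
      = v (site N M b (Fin.insertNth κ ⟨0, Nat.pos_of_ne_zero (NeZero.ne N)⟩ j') - unitVec (fine N M) κ)
        - v (site N M b (Fin.insertNth κ ⟨N - 1, Nat.sub_lt (Nat.pos_of_ne_zero (NeZero.ne N)) one_pos⟩ j')) := by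
  have hN : 0 < N := Nat.pos_of_ne_zero (NeZero.ne N)
  -- the `κ`-line through the frozen offsets, parametrised by the `κ`-coordinate `s ∈ ℕ`
  obtain ⟨ℓ, hℓ⟩ : ∃ ℓ : ℕ → Tor (fine N M), ℓ = fun s μ =>
      ((N * (b μ).val + (if μ = κ then s else ((Fin.insertNth (α := fun _ => Fin N) κ ⟨0, hN⟩ j' μ : Fin N) : ℕ)) : ℕ) : ZMod (fine N M μ)) := ⟨_, rfl⟩
  have hpt : ∀ t : Fin N, site N M b (Fin.insertNth κ t j') = ℓ (t : ℕ) := fun t => by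
    rw [hℓ]
    funext μ
    by_cases hμ : μ = κ
    · subst hμ
      simp only [site, Fin.insertNth_apply_same, if_true]
    · obtain ⟨i, rfl⟩ := Fin.exists_succAbove_eq hμ
      simp only [site, Fin.insertNth_apply_succAbove, if_neg hμ]
  have hstep : ∀ s : ℕ, ℓ (s + 1) - unitVec (fine N M) κ = ℓ s := fun s => by
    rw [hℓ]
    funext μ
    by_cases hμ : μ = κ
    · subst hμ
      simp only [unitVec, Pi.sub_apply, Pi.single_eq_same, if_true]
      push_cast
      ring
    · simp only [unitVec, Pi.sub_apply, Pi.single_eq_of_ne hμ, if_neg hμ, sub_zero]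
  simp_rw [hpt]
  rw [Fin.sum_univ_eq_sum_range (fun s => v (ℓ s - unitVec (fine N M) κ) - v (ℓ s)) N]
  have hrw : ∀ s ∈ Finset.range N, v (ℓ s - unitVec (fine N M) κ) - v (ℓ s)
      = (fun s => v (ℓ s - unitVec (fine N M) κ)) s - (fun s => v (ℓ s - unitVec (fine N M) κ)) (s + 1) := fun s _ => by
    simp only [hstep]
  rw [Finset.sum_congr rfl hrw, Finset.sum_range_sub']
  have hlast := hstep (N - 1)
  rw [Nat.sub_add_cancel hN] at hlast
  rw [hlast]

omit [∀ μ, NeZero (M μ)] in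
/-- **A BLOCK SUM OF BACKWARD DIFFERENCES IS AN ENTERING-FACE SUM MINUS A LEAVING-FACE SUM**: split the block offsets by the `κ`-coordinate
(`Fin.insertNthEquiv`) and telescope each `κ`-line. [folklore] -/
theorem sum_block_bdiff_eq (v : Tor (fine N M) → ℝ) (b : Tor M) (κ : Fin (d + 1)) :
    ∑ j : Fin (d + 1) → Fin N, (v (site N M b j - unitVec (fine N M) κ) - v (site N M b j))
      = ∑ j' : Fin d → Fin N, (v (site N M b (Fin.insertNth κ ⟨0, Nat.pos_of_ne_zero (NeZero.ne N)⟩ j') - unitVec (fine N M) κ)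
          - v (site N M b (Fin.insertNth κ ⟨N - 1, Nat.sub_lt (Nat.pos_of_ne_zero (NeZero.ne N)) one_pos⟩ j'))) := by
  rw [← (Fin.insertNthEquiv (fun _ => Fin N) κ).sum_comp (fun j => v (site N M b j - unitVec (fine N M) κ) - v (site N M b j)),
    Fintype.sum_prod_type_right]
  exact Finset.sum_congr rfl fun j' _ => sum_line_bdiff_eq N M v b κ j'

/-- ★ **THE FACE LEMMA.**  For a field `v` vanishing off the unit block `y″` with `|v| ≤ S` (`S ≥ 0`), the block mean of its scaled backward
difference `N(v(· − e_κ) − v)` at `x` is at most `(2·𝟙[y″ = B(x)] + 𝟙[y″ = B(x) − e_κ])·S`: of the `N^{d+1}` differences only the `2N^d` face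
terms survive the telescoping, each entering-face point lying in `B(x)` or in `B(x) − e_κ` (n15-c `blockOf_sub_unitVec`). [cite: King1986, (4.36) p.674, p.664 (blocks B^k(x))] -/
theorem abs_blockMean_bdiff_apply_le {v : Tor (fine N M) → ℝ} {y'' : Tor M} {S : ℝ} (hS : 0 ≤ S)
    (hloc : ∀ y, blockOf N M y ≠ y'' → v y = 0) (hb : ∀ y, |v y| ≤ S) (κ : Fin (d + 1)) (x : Tor (fine N M)) :
    |Matrix.mulVecLin (blockProj N M)
        ((((N : ℝ) • (pull (fun y : Tor (fine N M) => y - unitVec (fine N M) κ) - LinearMap.id)) : (Tor (fine N M) → ℝ) →ₗ[ℝ] (Tor (fine N M) → ℝ)) v) x|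
      ≤ (2 * (if y'' = blockOf N M x then 1 else 0) + (if y'' = blockOf N M x - unitVec M κ then 1 else 0)) * S := by
  have hN0 : 0 < N := Nat.pos_of_ne_zero (NeZero.ne N)
  have hNr : (0 : ℝ) < (N : ℝ) := by exact_mod_cast hN0
  set b := blockOf N M x with hb_def
  -- the block mean of the scaled backward difference as `N^{−d}·(face sums)`
  have hsum : Matrix.mulVecLin (blockProj N M)
        ((((N : ℝ) • (pull (fun y : Tor (fine N M) => y - unitVec (fine N M) κ) - LinearMap.id)) : (Tor (fine N M) → ℝ) →ₗ[ℝ] (Tor (fine N M) → ℝ)) v) x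
      = ((N : ℝ) ^ (d + 1))⁻¹ * ((N : ℝ) * ∑ j' : Fin d → Fin N,
          (v (site N M b (Fin.insertNth κ ⟨0, hN0⟩ j') - unitVec (fine N M) κ)
            - v (site N M b (Fin.insertNth κ ⟨N - 1, Nat.sub_lt hN0 one_pos⟩ j')))) := by
    have h1 : ∑ j : Fin (d + 1) → Fin N, ((((N : ℝ) • (pull (fun y : Tor (fine N M) => y - unitVec (fine N M) κ) - LinearMap.id))
          : (Tor (fine N M) → ℝ) →ₗ[ℝ] (Tor (fine N M) → ℝ)) v) (site N M b j)
        = (N : ℝ) * ∑ j : Fin (d + 1) → Fin N, (v (site N M b j - unitVec (fine N M) κ) - v (site N M b j)) := by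
      rw [Finset.mul_sum]
      exact Finset.sum_congr rfl fun j _ => bdiff_apply N M κ v _
    rw [blockMean_apply_eq_sum, h1, sum_block_bdiff_eq]
  rw [hsum]
  -- each line contributes at most `(2·𝟙[y″ = b] + 𝟙[y″ = b − e_κ])·S`
  have hi1 : 0 ≤ (if y'' = b then (1 : ℝ) else 0) := by split_ifs <;> norm_num
  have hi2 : 0 ≤ (if y'' = b - unitVec M κ then (1 : ℝ) else 0) := by split_ifs <;> norm_num
  have hline : ∀ j' : Fin d → Fin N,
      |v (site N M b (Fin.insertNth κ ⟨0, hN0⟩ j') - unitVec (fine N M) κ) - v (site N M b (Fin.insertNth κ ⟨N - 1, Nat.sub_lt hN0 one_pos⟩ j'))|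
        ≤ (2 * (if y'' = b then 1 else 0) + (if y'' = b - unitVec M κ then 1 else 0)) * S := by
    intro j'
    set z₀ := site N M b (Fin.insertNth κ ⟨0, hN0⟩ j') with hz₀
    set z₁ := site N M b (Fin.insertNth κ ⟨N - 1, Nat.sub_lt hN0 one_pos⟩ j') with hz₁
    have hBz₀ : blockOf N M z₀ = b := blockOf_site N M b _
    have hBz₁ : blockOf N M z₁ = b := blockOf_site N M b _
    -- the leaving-face point lies in `b`
    have h1 : |v z₁| ≤ (if y'' = b then 1 else 0) * S := by
      by_cases hy : y'' = b
      · rw [if_pos hy, one_mul]; exact hb z₁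
      · rw [if_neg hy, zero_mul, hloc z₁ (by rw [hBz₁]; exact Ne.symm hy), abs_zero]
    -- the entering-face point lies in `b` or in `b − e_κ`
    have h0 : |v (z₀ - unitVec (fine N M) κ)| ≤ ((if y'' = b then 1 else 0) + (if y'' = b - unitVec M κ then 1 else 0)) * S := by
      rcases blockOf_sub_unitVec N M z₀ κ with h | h
      · by_cases hy : y'' = b
        · rw [if_pos hy]
          calc |v (z₀ - unitVec (fine N M) κ)| ≤ S := hb _
            _ = (1 + 0) * S := by ring
            _ ≤ (1 + (if y'' = b - unitVec M κ then 1 else 0)) * S := mul_le_mul_of_nonneg_right (add_le_add le_rfl hi2) hS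
        · rw [hloc _ (by rw [h, hBz₀]; exact Ne.symm hy), abs_zero]
          exact mul_nonneg (add_nonneg hi1 hi2) hS
      · by_cases hy : y'' = b - unitVec M κ
        · rw [if_pos hy]
          calc |v (z₀ - unitVec (fine N M) κ)| ≤ S := hb _
            _ = (0 + 1) * S := by ring
            _ ≤ ((if y'' = b then 1 else 0) + 1) * S := mul_le_mul_of_nonneg_right (add_le_add hi1 le_rfl) hS
        · rw [hloc _ (by rw [h, hBz₀]; exact Ne.symm hy), abs_zero]
          exact mul_nonneg (add_nonneg hi1 hi2) hS
    calc |v (z₀ - unitVec (fine N M) κ) - v z₁| ≤ |v (z₀ - unitVec (fine N M) κ)| + |v z₁| := abs_sub _ _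
      _ ≤ ((if y'' = b then 1 else 0) + (if y'' = b - unitVec M κ then 1 else 0)) * S + (if y'' = b then 1 else 0) * S := add_le_add h0 h1
      _ = (2 * (if y'' = b then 1 else 0) + (if y'' = b - unitVec M κ then 1 else 0)) * S := by ring
  -- sum the `N^d` lines
  have hcard : (Finset.univ : Finset (Fin d → Fin N)).card = N ^ d := by
    rw [Finset.card_univ, Fintype.card_pi, Finset.prod_const, Fintype.card_fin, Finset.card_univ, Fintype.card_fin]
  set A : ℝ := (2 * (if y'' = b then 1 else 0) + (if y'' = b - unitVec M κ then 1 else 0)) * S with hA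
  rw [abs_mul, abs_mul, abs_of_pos (inv_pos.mpr (pow_pos hNr _)), abs_of_pos hNr]
  calc ((N : ℝ) ^ (d + 1))⁻¹ * ((N : ℝ) * |∑ j' : Fin d → Fin N,
          (v (site N M b (Fin.insertNth κ ⟨0, hN0⟩ j') - unitVec (fine N M) κ) - v (site N M b (Fin.insertNth κ ⟨N - 1, Nat.sub_lt hN0 one_pos⟩ j')))|)
      ≤ ((N : ℝ) ^ (d + 1))⁻¹ * ((N : ℝ) * ∑ j' : Fin d → Fin N, A) := by
        refine mul_le_mul_of_nonneg_left (mul_le_mul_of_nonneg_left ?_ hNr.le) (inv_pos.mpr (pow_pos hNr _)).le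
        exact (Finset.abs_sum_le_sum_abs _ _).trans (Finset.sum_le_sum fun j' _ => hline j')
    _ = A := by
        rw [Finset.sum_const, hcard, nsmul_eq_mul]
        push_cast
        field_simp
        ring

end Face

/-! ## §4 ★ The block mean annihilates the cell oscillation of King's pairing exactly -/

section Annihilation

variable [NeZero L] (k m : ℕ) (M : Fin (d + 1) → ℕ) [∀ μ, NeZero (M μ)]

/-- The fibre of the bond pairing over `(w, i)` is the fibre of the point pairing over `w`, in colour `i`. [folklore] -/
theorem fibre_kingPrV_eq_map (w : Tor (fine (L ^ k) M)) (i : Fin (d + 1)) :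
    fibre (kingPrV L k m M) (w, i) = (Finset.univ.filter fun z' : Tor (fine (L ^ m * L ^ k) M) => kingPr L k m M z' = w).map
      ⟨fun z' => (z', i), fun _ _ h => (Prod.mk.inj h).1⟩ := by
  ext ⟨z', a⟩
  simp only [mem_fibre, kingPrV_eq, Prod.mk.injEq, Finset.mem_map, Finset.mem_filter, Finset.mem_univ, true_and, Function.Embedding.coeFn_mk]
  constructor
  · rintro ⟨hz, ha⟩; exact ⟨z', hz, rfl, ha.symm⟩
  · rintro ⟨z₁, hz₁, rfl, hia⟩; exact ⟨hz₁, hia.symm⟩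

/-- **ZERO CELL SUMS**: over every cell of King's pairing, `c′ − blockAvg_π c′` sums to zero (in each colour). [folklore] -/
theorem sum_fibre_sub_blockAvg (c' : Tor (fine (L ^ m * L ^ k) M) × Fin (d + 1) → ℝ) (w : Tor (fine (L ^ k) M)) (i : Fin (d + 1)) :
    ∑ z' ∈ Finset.univ.filter (fun z' : Tor (fine (L ^ m * L ^ k) M) => kingPr L k m M z' = w),
      (c' (z', i) - blockAvg (kingPrV L k m M) c' (w, i)) = 0 := by
  set S := Finset.univ.filter (fun z' : Tor (fine (L ^ m * L ^ k) M) => kingPr L k m M z' = w) with hS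
  have havg : blockAvg (kingPrV L k m M) c' (w, i) = (∑ z' ∈ S, c' (z', i)) / S.card := by
    rw [blockAvg, fibre_kingPrV_eq_map, Finset.sum_map, Finset.card_map]
    rfl
  rw [Finset.sum_sub_distrib, Finset.sum_const, nsmul_eq_mul, havg]
  by_cases hc : (S.card : ℝ) = 0
  · have hS0 : S = ∅ := Finset.card_eq_zero.mp (by exact_mod_cast hc)
    rw [hS0]; simp
  · rw [mul_div_cancel₀ _ hc, sub_self]

/-- ★ **THE BLOCK MEAN ANNIHILATES THE CELL OSCILLATION OF KING's PAIRING, EXACTLY**: `(Q′*Q′ ⊗ 1) ∘ 𝔇(M_{c′}, M_{blockAvg_π c′}) = 0` on the 1-form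
carrier, `π = kingPrV L k m M`, `𝔇 = idef (pull π) (pull π)`.  Pointwise `𝔇(M_{c′}, M_{blockAvg_π c′})g (z′, i) = (c′(z′, i) − (blockAvg_π c′)(πz′, i))·
g(πz′, i)` (`T4EtaRateCoeffDefect.idef_mulOp_apply`); a unit block of the `η′`-torus is a union of cells (`blkFine_comp_kingPrV`), the factor
`g(πz′, i)` is constant on each cell, and the cell sums of `c′ − blockAvg_π c′∘π` vanish (`sum_fibre_sub_blockAvg`). [cite: King1986, (4.36) p.674, p.664 (pairing convention «x′ ∈ B^n(x)»)] -/
theorem tensorId_blockMean_comp_idef_mulOp_blockAvg (c' : Tor (fine (L ^ m * L ^ k) M) × Fin (d + 1) → ℝ) :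
    tensorId (Fin (d + 1)) (Matrix.mulVecLin (blockProj (L ^ m * L ^ k) M))
        ∘ₗ idef (pull (kingPrV L k m M)) (pull (kingPrV L k m M)) (mulOp c') (mulOp (blockAvg (kingPrV L k m M) c')) = 0 := by
  refine LinearMap.ext fun g => funext fun p => ?_
  obtain ⟨x', i⟩ := p
  rw [LinearMap.comp_apply, tensorId_apply, LinearMap.zero_apply, Pi.zero_apply, Matrix.mulVecLin_apply, blockProj_mulVec_apply]
  have hF : ∀ z' : Tor (fine (L ^ m * L ^ k) M),
      idef (pull (kingPrV L k m M)) (pull (kingPrV L k m M)) (mulOp c') (mulOp (blockAvg (kingPrV L k m M) c')) g (z', i)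
        = (c' (z', i) - blockAvg (kingPrV L k m M) c' (kingPr L k m M z', i)) * g (kingPr L k m M z', i) := fun z' => by
    rw [idef_mulOp_apply, kingPrV_eq]
  have hB : ∀ z' : Tor (fine (L ^ m * L ^ k) M), blockOf (L ^ m * L ^ k) M z' = blockOf (L ^ k) M (kingPr L k m M z') := fun z' => by
    have h := congrFun (blkFine_comp_kingPrV M L k m) (z', i)
    simpa only [Function.comp_apply, blkFine, kingPrV_eq] using h.symm
  simp_rw [hF]
  rw [← Finset.sum_fiberwise Finset.univ (kingPr L k m M)
    (fun z' => (if blockOf (L ^ m * L ^ k) M x' = blockOf (L ^ m * L ^ k) M z' then ((((L ^ m * L ^ k : ℕ) : ℝ)) ^ (d + 1))⁻¹ else 0)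
      * ((c' (z', i) - blockAvg (kingPrV L k m M) c' (kingPr L k m M z', i)) * g (kingPr L k m M z', i)))]
  refine Finset.sum_eq_zero fun w _ => ?_
  have hrw : ∀ z' ∈ Finset.univ.filter (fun z' : Tor (fine (L ^ m * L ^ k) M) => kingPr L k m M z' = w),
      (if blockOf (L ^ m * L ^ k) M x' = blockOf (L ^ m * L ^ k) M z' then ((((L ^ m * L ^ k : ℕ) : ℝ)) ^ (d + 1))⁻¹ else 0)
        * ((c' (z', i) - blockAvg (kingPrV L k m M) c' (kingPr L k m M z', i)) * g (kingPr L k m M z', i))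
      = ((if blockOf (L ^ m * L ^ k) M x' = blockOf (L ^ k) M w then ((((L ^ m * L ^ k : ℕ) : ℝ)) ^ (d + 1))⁻¹ else 0) * g (w, i))
        * (c' (z', i) - blockAvg (kingPrV L k m M) c' (w, i)) := by
    intro z' hz'
    rw [Finset.mem_filter] at hz'
    rw [hB z', hz'.2]
    ring
  rw [Finset.sum_congr rfl hrw, ← Finset.mul_sum, sum_fibre_sub_blockAvg, mul_zero]

end Annihilation

end Summit.QuantumFields.YangMills.BalabanUVNodes.N15.KingModel.Constraint

end
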